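import Mathlib
import Summits.Ventures.PercRepro2.PMK5Deg2Kernel
import Summits.Ventures.PercRepro2.Deg2Kron
import Summits.Ventures.PercRepro2.Deg2Digits
import Summits.Ventures.PercRepro2.Deg2Typed
import Summits.Ventures.PercRepro2.SevenKernel
import Summits.Ventures.PercRepro2.SevenConn
import Summits.Ventures.PercRepro2.SevenTables

/-!
# ROW 2′TRI AND (HCOV) ON EVERY SEVEN-VERTEX TWELVE-EDGE SKELETON WITH A KERNEL CERTIFICATE — THE BRIDGE, for EVERY edge list
(blind cell PercRepro2, mine-2 g34; `Deg2Typed.lean` (mine-2 g26, Theorem 27) with the graph itself the parameter;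
the certificates are `SevenCerts*.lean`, one `decide +kernel` per skeleton)

By `SevenTables.K3_apply`, on the skeleton `ends edge` with the marks `(o, a₁, a₂, a₃, b) = (0, 1, 2, 3, 4)` the
kernel `K₃ x y w` is a signed sum of twenty products of tables, so a typed count `typedCount F z τ K₃` is the
signed triple count of the profile `k` of the minor `(F, z, τ)` (`typedCount_K3_eq`: `cntPos k − cntNeg k`).
A kernel certificate `Cert edge` (`SevenKernel.lean`, one `decide +kernel` over `Fin 12 → Bool` per skeleton) reads
the counts off the base-`Deg2.KB` digits of `kPos`, `kNeg` (`kPos_eq`, `kNeg_eq` through `Deg2.kron_eq_kronSum` and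
`Deg2.kronSum_mul_mul`; `Deg2.le_of_kron_le'`: the digits of `kNeg` are below `2^23` by the third mask test, the counts
are below `Deg2.KB`, so the subtraction borrows nowhere), hence

* **`cntNeg_le_cntPos`**: `Cert edge → ∀ k, cntNeg edge k ≤ cntPos edge k`;
* **`typedCount_K3_nonneg`**: every weight-free typed count of `K₃` on the skeleton is `≥ 0` — all minors `(F, z)`,
  all type maps;
* **`typedBases`**: `Cert edge → CovForm.TypedBases (ends edge) 0 1 2 3 4` — row 2′TRI on the skeleton;
* **`HCov_seven`**: `Cert edge → CovForm.HCov p (ends edge) 0 1 2 3 4` for every probability vector `p : Fin 12 → R` —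
  (HCOV) on every instance of the skeleton (the twelve edges at any weights, missing edges at weight `0`), by
  `CovForm.HCov_of_typedBases`.

The design is GENERIC: any seven-vertex marked graph with at most twelve edges (loops and parallel edges allowed; the
marks at `0, 1, 2, 3, 4`, the unmarked vertices `5, 6`) is (HCOV)-certified for every weight vector by one
`decide +kernel` of its `Cert`.
-/

namespace Summit.Ventures.PercRepro2

open Hub

namespace Seven

/-! ## Typed counts are signed triple counts -/

section Counts

variable {R : Type*} [Field R] (edge : Fin 12 → Fin 7 × Fin 7)

/-- The positive triple counts of `K₃` on the skeleton. -/
def cntPos (edge : Fin 12 → Fin 7 × Fin 7) (k : Fin 12 → Fin 4) : ℕ :=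
  Deg2.cnt3 (tPD edge) (tQ edge) (t4p edge) k + Deg2.cnt3 (tQ edge) (tPDoU edge) (t5p edge) k + Deg2.cnt3 (tPD edge) (tQ edge) (t6m edge) k +
    Deg2.cnt3 (tPD edge) (t7p edge 4) (t7m edge 0) k + Deg2.cnt3 (tPD edge) (t7m edge 4) (t7p edge 0) k +
    Deg2.cnt3 (tPDoU edge) (t7p edge 4) (t7m edge 3) k + Deg2.cnt3 (tPDoU edge) (t7m edge 4) (t7p edge 3) k +
    Deg2.cnt3 (tPD edge) (t7p edge 4) (t10p edge) k + Deg2.cnt3 (tPD edge) (t7m edge 4) (t10m edge) k + Deg2.cnt3 (tQ edge) (t12 edge) (tPDoU edge) k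

/-- The negative triple counts of `K₃` on the skeleton. -/
def cntNeg (edge : Fin 12 → Fin 7 × Fin 7) (k : Fin 12 → Fin 4) : ℕ :=
  Deg2.cnt3 (tPD edge) (tQ edge) (t4m edge) k + Deg2.cnt3 (tQ edge) (tPDoU edge) (t5m edge) k + Deg2.cnt3 (tPD edge) (tQ edge) (t6p edge) k +
    Deg2.cnt3 (tPD edge) (t7p edge 4) (t7p edge 0) k + Deg2.cnt3 (tPD edge) (t7m edge 4) (t7m edge 0) k +
    Deg2.cnt3 (tPDoU edge) (t7p edge 4) (t7p edge 3) k + Deg2.cnt3 (tPDoU edge) (t7m edge 4) (t7m edge 3) k +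
    Deg2.cnt3 (tPD edge) (t7p edge 4) (t10m edge) k + Deg2.cnt3 (tPD edge) (t7m edge 4) (t10p edge) k + Deg2.cnt3 (tPD edge) (tQ edge) (t11 edge) k

/-- The profile of a minor `(F, z)` with types `τ ≤ 3` on `F`: `τ` on `F`, `3 · z` off `F`. -/
lemma exists_profile (F : Finset (Fin 12)) (z : Config (Fin 12)) (τ : Fin 12 → ℕ)
    (hτ : ∀ e ∈ F, τ e ≤ 3) :
    ∃ k : Fin 12 → Fin 4, ∀ e, (k e : ℕ) = if e ∈ F then τ e else if z e then 3 else 0 := by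
  refine ⟨fun e => if he : e ∈ F then ⟨τ e, Nat.lt_succ_of_le (hτ e he)⟩ else if z e then 3 else 0,
    fun e => ?_⟩
  by_cases he : e ∈ F
  · simp [he]
  · simp only [dif_neg he, if_neg he]
    cases z e <;> rfl

/-- The constraint of a typed count is the profile constraint `prof x y w = k`. -/
lemma typed_constraint_iff (F : Finset (Fin 12)) (z : Config (Fin 12)) (τ : Fin 12 → ℕ)
    (k : Fin 12 → Fin 4) (hk : ∀ e, (k e : ℕ) = if e ∈ F then τ e else if z e then 3 else 0)
    (x y w : Config (Fin 12)) :
    ((∀ e, e ∉ F → x e = z e ∧ y e = z e ∧ w e = z e) ∧ (∀ e ∈ F, openCount x y w e = τ e)) ↔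
      prof x y w = k := by
  constructor
  · rintro ⟨h1, h2⟩
    funext e
    apply Fin.ext
    rw [hk e]
    by_cases he : e ∈ F
    · rw [if_pos he]
      exact h2 e he
    · rw [if_neg he]
      obtain ⟨hx, hy, hw⟩ := h1 e he
      simp only [Hub.prof, hx, hy, hw]
      cases z e <;> rfl
  · intro hprof
    constructor
    · intro e he
      have := congrArg (fun f => (f e : ℕ)) hprof
      simp only [Hub.prof] at this
      rw [hk e, if_neg he] at this
      revert this
      cases z e <;> cases x e <;> cases y e <;> cases w e <;> intro this <;> simp at this ⊢
    · intro e he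
      have := congrArg (fun f => (f e : ℕ)) hprof
      simp only [Hub.prof] at this
      rw [hk e, if_pos he] at this
      exact this

/-- The typed count of a product of three tables is the triple count of the profile. -/
lemma typedCount_tables (F : Finset (Fin 12)) (z : Config (Fin 12)) (τ : Fin 12 → ℕ)
    (k : Fin 12 → Fin 4) (hk : ∀ e, (k e : ℕ) = if e ∈ F then τ e else if z e then 3 else 0)
    (T₁ T₂ T₃ : (Fin 12 → Bool) → Bool) :
    typedCount F z τ (fun x y w => indR (R := R) T₁ x * indR T₂ y * indR T₃ w) =
      ((Deg2.cnt3 T₁ T₂ T₃ k : ℕ) : R) := by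
  rw [← coef3_eq_cnt3]
  unfold typedCount coef3
  simp only [typed_constraint_iff F z τ k hk, Finset.sum_filter, Fintype.sum_prod_type]

/-- A typed count is linear in the kernel (sums). -/
lemma typedCount_add (F : Finset (Fin 12)) (z : Config (Fin 12)) (τ : Fin 12 → ℕ)
    (K K' : Config (Fin 12) → Config (Fin 12) → Config (Fin 12) → R) :
    typedCount F z τ (fun x y w => K x y w + K' x y w) = typedCount F z τ K + typedCount F z τ K' := by
  unfold typedCount
  simp only [← Finset.sum_add_distrib]
  refine Finset.sum_congr rfl fun x _ => Finset.sum_congr rfl fun y _ =>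
    Finset.sum_congr rfl fun w _ => ?_
  split_ifs <;> simp

/-- A typed count is linear in the kernel (differences). -/
lemma typedCount_sub (F : Finset (Fin 12)) (z : Config (Fin 12)) (τ : Fin 12 → ℕ)
    (K K' : Config (Fin 12) → Config (Fin 12) → Config (Fin 12) → R) :
    typedCount F z τ (fun x y w => K x y w - K' x y w) = typedCount F z τ K - typedCount F z τ K' := by
  unfold typedCount
  simp only [← Finset.sum_sub_distrib]
  refine Finset.sum_congr rfl fun x _ => Finset.sum_congr rfl fun y _ =>
    Finset.sum_congr rfl fun w _ => ?_
  split_ifs <;> simp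

/-- **A typed count of `K₃` on the skeleton is the signed triple count of its profile.** -/
lemma typedCount_K3_eq (F : Finset (Fin 12)) (z : Config (Fin 12)) (τ : Fin 12 → ℕ)
    (k : Fin 12 → Fin 4) (hk : ∀ e, (k e : ℕ) = if e ∈ F then τ e else if z e then 3 else 0) :
    typedCount F z τ (CovForm.K3 (R := R) (ends edge) 0 1 2 3 4) =
      ((cntPos edge k : ℕ) : R) - ((cntNeg edge k : ℕ) : R) := by
  have hK : CovForm.K3 (R := R) (ends edge) 0 1 2 3 4 = fun a b c =>
      (indR (tPD edge) a * indR (tQ edge) b * indR (t4p edge) c + indR (tQ edge) a * indR (tPDoU edge) b * indR (t5p edge) c +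
        indR (tPD edge) a * indR (tQ edge) b * indR (t6m edge) c +
        indR (tPD edge) a * indR (t7p edge 4) b * indR (t7m edge 0) c + indR (tPD edge) a * indR (t7m edge 4) b * indR (t7p edge 0) c +
        indR (tPDoU edge) a * indR (t7p edge 4) b * indR (t7m edge 3) c + indR (tPDoU edge) a * indR (t7m edge 4) b * indR (t7p edge 3) c +
        indR (tPD edge) a * indR (t7p edge 4) b * indR (t10p edge) c + indR (tPD edge) a * indR (t7m edge 4) b * indR (t10m edge) c +
        indR (tQ edge) a * indR (t12 edge) b * indR (tPDoU edge) c) -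
      (indR (tPD edge) a * indR (tQ edge) b * indR (t4m edge) c + indR (tQ edge) a * indR (tPDoU edge) b * indR (t5m edge) c +
        indR (tPD edge) a * indR (tQ edge) b * indR (t6p edge) c +
        indR (tPD edge) a * indR (t7p edge 4) b * indR (t7p edge 0) c + indR (tPD edge) a * indR (t7m edge 4) b * indR (t7m edge 0) c +
        indR (tPDoU edge) a * indR (t7p edge 4) b * indR (t7p edge 3) c + indR (tPDoU edge) a * indR (t7m edge 4) b * indR (t7m edge 3) c +
        indR (tPD edge) a * indR (t7p edge 4) b * indR (t10m edge) c + indR (tPD edge) a * indR (t7m edge 4) b * indR (t10p edge) c +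
        indR (tPD edge) a * indR (tQ edge) b * indR (t11 edge) c) := by
    funext a b c
    exact K3_apply edge a b c
  rw [hK, typedCount_sub]
  simp only [typedCount_add, typedCount_tables F z τ k hk]
  unfold cntPos cntNeg
  push_cast
  ring

end Counts

/-! ## The digit bridge -/

section Digits

/-- Ten Kronecker sums combine. -/
lemma sum_add_mul10 (f₁ f₂ f₃ f₄ f₅ f₆ f₇ f₈ f₉ f₁₀ : (Fin 12 → Fin 4) → ℕ) :
    ∑ k, f₁ k * Deg2.KB ^ Deg2.idx4 k + ∑ k, f₂ k * Deg2.KB ^ Deg2.idx4 k + ∑ k, f₃ k * Deg2.KB ^ Deg2.idx4 k +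
      ∑ k, f₄ k * Deg2.KB ^ Deg2.idx4 k + ∑ k, f₅ k * Deg2.KB ^ Deg2.idx4 k + ∑ k, f₆ k * Deg2.KB ^ Deg2.idx4 k +
      ∑ k, f₇ k * Deg2.KB ^ Deg2.idx4 k + ∑ k, f₈ k * Deg2.KB ^ Deg2.idx4 k + ∑ k, f₉ k * Deg2.KB ^ Deg2.idx4 k +
      ∑ k, f₁₀ k * Deg2.KB ^ Deg2.idx4 k =
      ∑ k, (f₁ k + f₂ k + f₃ k + f₄ k + f₅ k + f₆ k + f₇ k + f₈ k + f₉ k + f₁₀ k) * Deg2.KB ^ Deg2.idx4 k := by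
  simp only [← Finset.sum_add_distrib]
  exact Finset.sum_congr rfl fun k _ => by ring

/-- `kPos` carries the positive counts. -/
lemma kPos_eq (edge : Fin 12 → Fin 7 × Fin 7) : kPos edge = ∑ k, cntPos edge k * Deg2.KB ^ Deg2.idx4 k := by
  unfold kPos
  simp only [Deg2.kron_eq_kronSum, Deg2.kronSum_mul_mul]
  rw [sum_add_mul10]
  rfl

/-- `kNeg` carries the negative counts. -/
lemma kNeg_eq (edge : Fin 12 → Fin 7 × Fin 7) : kNeg edge = ∑ k, cntNeg edge k * Deg2.KB ^ Deg2.idx4 k := by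
  unfold kNeg
  simp only [Deg2.kron_eq_kronSum, Deg2.kronSum_mul_mul]
  rw [sum_add_mul10]
  rfl

/-- The positive counts are below `Deg2.KB` (ten counts `≤ 3^12`). -/
lemma cntPos_lt (edge : Fin 12 → Fin 7 × Fin 7) (k : Fin 12 → Fin 4) : cntPos edge k < Deg2.KB := by
  unfold cntPos
  rw [Deg2.KB_val]
  have := Deg2.cnt3_le (tPD edge) (tQ edge) (t4p edge) k
  have := Deg2.cnt3_le (tQ edge) (tPDoU edge) (t5p edge) k
  have := Deg2.cnt3_le (tPD edge) (tQ edge) (t6m edge) k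
  have := Deg2.cnt3_le (tPD edge) (t7p edge 4) (t7m edge 0) k
  have := Deg2.cnt3_le (tPD edge) (t7m edge 4) (t7p edge 0) k
  have := Deg2.cnt3_le (tPDoU edge) (t7p edge 4) (t7m edge 3) k
  have := Deg2.cnt3_le (tPDoU edge) (t7m edge 4) (t7p edge 3) k
  have := Deg2.cnt3_le (tPD edge) (t7p edge 4) (t10p edge) k
  have := Deg2.cnt3_le (tPD edge) (t7m edge 4) (t10m edge) k
  have := Deg2.cnt3_le (tQ edge) (t12 edge) (tPDoU edge) k
  omega

/-- The negative counts are below `Deg2.KB`. -/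
lemma cntNeg_lt (edge : Fin 12 → Fin 7 × Fin 7) (k : Fin 12 → Fin 4) : cntNeg edge k < Deg2.KB := by
  unfold cntNeg
  rw [Deg2.KB_val]
  have := Deg2.cnt3_le (tPD edge) (tQ edge) (t4m edge) k
  have := Deg2.cnt3_le (tQ edge) (tPDoU edge) (t5m edge) k
  have := Deg2.cnt3_le (tPD edge) (tQ edge) (t6p edge) k
  have := Deg2.cnt3_le (tPD edge) (t7p edge 4) (t7p edge 0) k
  have := Deg2.cnt3_le (tPD edge) (t7m edge 4) (t7m edge 0) k
  have := Deg2.cnt3_le (tPDoU edge) (t7p edge 4) (t7p edge 3) k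
  have := Deg2.cnt3_le (tPDoU edge) (t7m edge 4) (t7m edge 3) k
  have := Deg2.cnt3_le (tPD edge) (t7p edge 4) (t10m edge) k
  have := Deg2.cnt3_le (tPD edge) (t7m edge 4) (t10p edge) k
  have := Deg2.cnt3_le (tPD edge) (tQ edge) (t11 edge) k
  omega

/-- **Every typed coefficient of `K₃` on the skeleton is `≥ 0`** given the kernel certificate of the pair:
`cntNeg edge k ≤ cntPos edge k`. -/
theorem cntNeg_le_cntPos (edge : Fin 12 → Fin 7 × Fin 7) (hc : Cert edge) (k : Fin 12 → Fin 4) :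
    cntNeg edge k ≤ cntPos edge k :=
  Deg2.le_of_kron_le' (cntPos edge) (cntNeg edge) (cntPos_lt edge) (cntNeg_lt edge) (kPos_eq edge) (kNeg_eq edge)
    hc.1 hc.2.1 hc.2.2 k

end Digits

/-! ## The typed base and (HCOV) on the family -/

section Base

variable {R : Type*} [Field R] [LinearOrder R] [IsStrictOrderedRing R]

/-- **Every weight-free typed count of `K₃` on the skeleton is nonnegative** — all minors `(F, z)`,
all type maps. -/
theorem typedCount_K3_nonneg (edge : Fin 12 → Fin 7 × Fin 7) (hc : Cert edge) (F : Finset (Fin 12)) (z : Config (Fin 12))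
    (τ : Fin 12 → ℕ) : 0 ≤ typedCount F z τ (CovForm.K3 (R := R) (ends edge) 0 1 2 3 4) := by
  by_cases hτ : ∀ e ∈ F, τ e ≤ 3
  · obtain ⟨k, hk⟩ := exists_profile F z τ hτ
    rw [typedCount_K3_eq edge F z τ k hk, sub_nonneg]
    exact_mod_cast cntNeg_le_cntPos edge hc k
  · have : typedCount F z τ (CovForm.K3 (R := R) (ends edge) 0 1 2 3 4) = 0 := by
      unfold typedCount
      refine Finset.sum_eq_zero fun x _ => Finset.sum_eq_zero fun y _ =>
        Finset.sum_eq_zero fun w _ => ?_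
      rw [if_neg]
      rintro ⟨-, h2⟩
      apply hτ
      intro e he
      rw [← h2 e he]
      unfold openCount
      have := Bool.toNat_le (x e)
      have := Bool.toNat_le (y e)
      have := Bool.toNat_le (w e)
      omega
    rw [this]

/-- **THEOREM 27 (typed form): row 2′TRI on the skeleton** given the pair's kernel certificate —
`CovForm.TypedBases (ends edge) 0 1 2 3 4`. -/
theorem typedBases (edge : Fin 12 → Fin 7 × Fin 7) (hc : Cert edge) : CovForm.TypedBases (R := R) (ends edge) 0 1 2 3 4 :=
  fun F z τ _ => typedCount_K3_nonneg edge hc F z τ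

/-- **THEOREM 27: (HCOV) on every the skeleton instance** given the pair's kernel certificate —
`CovForm.HCov p (ends edge) 0 1 2 3 4` for every probability vector `p : Fin 12 → R` (every weight vector,
missing edges at weight `0`). -/
theorem HCov_seven (edge : Fin 12 → Fin 7 × Fin 7) (hc : Cert edge) (p : Fin 12 → R) (hp : IsProbVec p) :
    CovForm.HCov p (ends edge) 0 1 2 3 4 :=
  CovForm.HCov_of_typedBases (ends edge) 0 1 2 3 4 (typedBases edge hc) p hp

end Base

end Seven

end Summit.Ventures.PercRepro2
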